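import Mathlib
import Literature.Geometry.Lorentzian.IPlusRegular
import Literature.Geometry.Lorentzian.Einstein
import HarnessLib

/-!
# Chruściel–Costa 2008, Theorem 4.5 with the spherical exterior slice: the product structure
`⟨⟨M_ext⟩⟩ ∪ 𝓔⁺ ≈ ℝ × (ℝ³ ∖ B(0,1))` of a vacuum `I⁺`-regular domain of outer communications
with connected horizon (named fact, D-0014; topic `Literature/Geometry/Lorentzian`)

P. T. Chruściel, J. Lopes Costa, *On uniqueness of stationary vacuum black holes*, Astérisque
**321** (2008) 195–265 = arXiv:0806.0016, §4.2, Theorem 4.5 (Structure theorem), printed: "Suppose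
that `(𝓜, ⁴g)` is [an `I⁺`-regular] stationary space-time invariant under a commutative group of
isometries `ℝ × 𝕋^{s-1}`, `s ≥ 1`, with the stationary Killing vector `K₍₀₎` tangent to the orbits of
the `ℝ` factor. There exists on `⟨⟨M_ext⟩⟩` a smooth time function `t`, invariant under `𝕋^{s-1}`,
which together with the flow of `K₍₀₎` induces the diffeomorphisms
`⟨⟨M_ext⟩⟩ ≈ ℝ × 𝒮̊₀`, `closure ⟨⟨M_ext⟩⟩ ∩ I⁺(M_ext) ≈ ℝ × 𝒮̄₀` (4.11), where `𝒮₀ := t⁻¹(0)` is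
asymptotically flat, (invariant under `𝕋^{s-1}`), with the boundary `∂𝒮̄₀` being a compact
cross-section of `𝓔⁺`. The smooth hypersurface with boundary `𝒮̄₀` is acausal, spacelike
up-to-boundary, and the flow of `K₍₀₎` is a translation along the `ℝ` factor in (4.11)."  In the
proof (Prop. 4.4 and the display after Thm. 4.5) `⟨⟨M_ext⟩⟩ ≈ ℝ × (𝒞⁺ ∪ 𝒮_ext)` with
`closure 𝒞⁺` COMPACT and `𝒮_ext ≈ ℝⁿ ∖ B(R)` the asymptotically flat end (§2.1), under the standing
hypothesis of §4.2 "`closure (𝒮 ∖ 𝒮_ext)` is compact", i.e. ONE asymptotically flat end — which for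
a globally hyperbolic `⟨⟨M_ext⟩⟩` satisfying the null energy condition is no loss of generality:
§2.4, Thm. 2.3 (Galloway) / Cor. 2.4, and §6.2 "we assume that `⟨⟨M_ext⟩⟩` contains only one
asymptotically flat region, which is necessarily the case under the hypotheses of Theorem 2.3"
(also p. 23: "by topological censorship, `⟨⟨M_ext⟩⟩` has only one asymptotically flat end").

THE TOPOLOGY OF THE SLICE in space-time dimension four.  P. T. Chruściel, R. M. Wald, *On the
topology of stationary black holes*, Class. Quantum Grav. **11** (1994) L147–L152 =
gr-qc/9410004, Thm. 2.3: for a stationary asymptotically flat space-time with a single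
asymptotically flat region whose `⟨⟨M_ext⟩⟩` is globally hyperbolic and satisfies the null energy
condition, (1) `⟨⟨M_ext⟩⟩` is simply connected; (2) if an achronal asymptotically flat slice of
`⟨⟨M_ext⟩⟩` has boundary a compact cross-section `K` of the horizon [and `𝒞' ∖ 𝒞_ext` has compact
closure — Chruściel–Costa Prop. 4.4], "each connected component of `K` is homeomorphic to a
sphere"; Remark 1 there: "if `Σ` is homeomorphic to the interior of a compact manifold with
boundary `Σ̄` [and simply connected], then each connected component of `∂Σ̄` is homeomorphic to a
sphere" (Hempel, *3-Manifolds*, Lemma 4.9) — this is Chruściel–Costa's Cor. 2.5.  Consequently,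
when `𝓔⁺ ≈ ℝ × ∂𝒮̄₀` is CONNECTED and `⟨⟨M_ext⟩⟩ ≈ ℝ × 𝒮̊₀` is SIMPLY CONNECTED, `𝒮̄₀` is a simply
connected smooth `3`-manifold with boundary `∂𝒮̄₀ ≈ S²`, equal to a compact set union one end
`≈ ℝ³ ∖ B(R)`; truncating the end at a large coordinate sphere leaves a compact simply connected
`3`-manifold with two boundary spheres, which by Perelman's theorem (the Poincaré–Perelman
theorem, 2002–2003; J. Morgan, G. Tian, *Ricci flow and the Poincaré c[…]*, Clay Math.
Monographs 3 (2007),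
Cor. 0.2 (a): a closed simply connected `3`-manifold is diffeomorphic to `S³`; with Alexander's
theorem, `S³` minus two disjoint smooth balls is `S² × [0,1]`) is `S² × [0,1]`.  Hence
`𝒮̄₀ ≈ S² × [0, ∞) ≈ {x ∈ ℝ³ | 1 ≤ ‖x‖}`, the boundary going to the unit sphere, smoothly on the
interior `𝒮̊₀ ≈ {x | 1 < ‖x‖}` — the picture `Σ₀ ∩ closure 𝐄 ≈ {x ∈ ℝ³ : |x| ≥ 1}` ASSUMED in
Ionescu–Klainerman, Invent. Math. 175 (2009), §1.1 and Alexakis–Ionescu–Klainerman 2010.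

Recorded here in the case `s = 1`, space-time dimension `4`, on a `StationaryAFBlackHole`
(`IPlusRegular.lean` renders Def. 1.1 as `IsIPlusRegular`; its hypersurface may have several ends,
whence the vacuum hypothesis `IsRicciFlat`, which supplies the null energy condition of the
censorship reduction to one end), with the two topological inputs it needs as HYPOTHESES
(`SimplyConnectedSpace 𝓑.doc`, which print derives from censorship, Cor. 2.4 — a weakening; and
`IsConnected 𝓑.horizon`: one, non-empty, horizon component), and with the conclusion COMPOSED with
the slice identification and WEAKENED to elementary vocabulary: there are maps `Ψ : ℝ × ℝ³ → M` and
`Φ : M → ℝ × ℝ³`, mutually inverse between the closed exterior `ℝ × {1 ≤ ‖x‖}` and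
`⟨⟨M_ext⟩⟩ ∪ 𝓔⁺ = 𝓑.doc ∪ 𝓑.horizon` (`= closure ⟨⟨M_ext⟩⟩ ∩ I⁺(M_ext)`, by (2.5) and
`⟨⟨M_ext⟩⟩ ⊆ I⁺(M_ext)`), continuous there in both directions (the HOMEOMORPHISM of (4.11) up to the
horizon), `C^∞` in both directions between the open exterior `ℝ × {1 < ‖x‖}` and `𝓑.doc` (the
DIFFEOMORPHISM of (4.11)), taking the cylinder `ℝ × {‖x‖ = 1}` onto `𝓔⁺`, and EQUIVARIANT: every
coordinate line `t ↦ Ψ (t, x)`, `1 ≤ ‖x‖`, is an integral curve of the stationary Killing field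
("the flow of `K₍₀₎` is a translation along the `ℝ` factor"; by uniqueness of integral curves this
is `φ_s (Ψ (t, x)) = Ψ (t + s, x)`).  The time-function property of `t = (Φ ·).1` (`∇t` timelike),
acausality and spacelikeness of the slices `{t = const}`, the asymptotic flatness of the induced
data and the smooth manifold-with-boundary structure up to `𝓔⁺` are deliberately NOT recorded.
-- TODO(general form): the `𝕋^{s-1}`-invariant version; higher dimensions (no slice topology);
-- several horizon components (`𝒮̄₀ ≈ ℝ³` minus `k` balls); diffeomorphism up to the boundary.

Used by the crux `NonTrappingHawkingRigidity` of the summit `FinalStateConjecture` (line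
`azimuthal-partial-analyticity`, stub `stub_invariantRadialFunction`: the `T`-invariant radial
function of the d.o.c. is `ρ := ‖(Φ ·).2‖ - 1`, on Kerr `r - r₊` up to reparametrisation; its
properties (R1)–(R6) there are chart bookkeeping over this fact).  The tree proves the strictly
stationary case of the product structure, without horizon and without the slice topology:
`IsIPlusRegular.exists_docTrivialization` (`DocStationarySpacetime.lean`); the time-function part
of Thm. 4.5 alone is the named fact `chruscielCosta2008_equivariantTimeFunction`
(`DocStructureTimeFunction.lean`).  The general `I⁺`-regular case rests on Prop. 4.6 (Wald's
averaging), the Lipschitz smoothing of §4.2, topological censorship and Perelman's theorem,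
none of which is in the tree.

## References
* P. T. Chruściel, J. Lopes Costa, Astérisque 321 (2008) 195–265, arXiv:0806.0016, §2.4 (Thm. 2.3,
  Cor. 2.4, Cor. 2.5), §4.2 (Prop. 4.4, Thm. 4.5, (4.11)), §6.2. [ChruscielCosta2008]
* P. T. Chruściel, R. M. Wald, Class. Quantum Grav. 11 (1994) L147–L152, gr-qc/9410004, Thm. 2.3 and
  Remark 1. [ChruscielWald1994Topology]
* J. Morgan, G. Tian, Ricci flow and the Poincaré c[…] (Perelman's theorem), Clay Math. Monographs 3,
  AMS 2007,
  Cor. 0.2 (a). [MorganTian2007]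
* J. Hempel, 3-Manifolds, Ann. of Math. Studies 86, Princeton 1976, Lemma 4.9. [Hempel1976]
* A. D. Ionescu, S. Klainerman, Invent. Math. 175 (2009) 35–102, §1.1 (the assumption
  `Σ₀ ≈ {x ∈ ℝ³ : |x| > 1/2}`, `S₀ = {|x| = 1}`).
-/

noncomputable section

open Bundle Set
open scoped Manifold ContDiff Topology

namespace Literature.Geometry.Lorentzian

/-- **Chruściel–Costa 2008, Thm. 4.5 (structure theorem, `s = 1`, dimension `4`) composed with the
identification of the slice `𝒮̄₀ ≈ {x ∈ ℝ³ | 1 ≤ ‖x‖}` (one asymptotically flat end by topological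
censorship under the null energy condition, Thm. 2.3 / §6.2; boundary a `2`-sphere, Cor. 2.5 =
Chruściel–Wald 1994, Thm. 2.3 with Hempel's Lemma 4.9; Poincaré–Perelman theorem, Morgan–Tian Cor. 0.2).**
For a vacuum, `I⁺`-regular stationary asymptotically flat black hole with simply connected domain
of outer communications and connected (non-empty) future event horizon there are `Ψ : ℝ × ℝ³ → M`
and `Φ : M → ℝ × ℝ³` such that: `Φ ∘ Ψ = id` on the closed exterior `{(t, x) | 1 ≤ ‖x‖}` and
`Ψ ∘ Φ = id` on `⟨⟨M_ext⟩⟩ ∪ 𝓔⁺`; `Ψ` maps the open exterior `{1 < ‖x‖}` onto `⟨⟨M_ext⟩⟩ = 𝓑.doc`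
and the cylinder `{‖x‖ = 1}` onto `𝓔⁺ = 𝓑.horizon`; `Ψ` is continuous on the closed exterior and
`Φ` on `⟨⟨M_ext⟩⟩ ∪ 𝓔⁺` (homeomorphism `ℝ × 𝒮̄₀ ≈ closure ⟨⟨M_ext⟩⟩ ∩ I⁺(M_ext)` of (4.11)); `Ψ` is
`C^∞` on the open exterior and `Φ` on `⟨⟨M_ext⟩⟩` (diffeomorphism `ℝ × 𝒮̊₀ ≈ ⟨⟨M_ext⟩⟩` of
(4.11)); and each line `t ↦ Ψ (t, x)`, `1 ≤ ‖x‖`, is an integral curve of the stationary Killing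
field ("the flow of `K₍₀₎` is a translation along the `ℝ` factor").  Weakening/composition of the
printed statements as explained in the module docstring.
[cite: ChruscielCosta2008, Thm. 4.5, (4.11); Thm. 2.3, Cor. 2.5, §6.2]
[cite: ChruscielWald1994Topology, Thm. 2.3 and Remark 1] [cite: MorganTian2007, Cor. 0.2 (a)] -/
def chruscielCosta2008_docProductStructure : Prop :=
  ∀ (𝓑 : StationaryAFBlackHole.{0}) [𝓑.metric.HasLeviCivita],
    𝓑.metric.toPseudoRiemannianMetric.IsRicciFlat → 𝓑.IsIPlusRegular →
    SimplyConnectedSpace 𝓑.doc → IsConnected 𝓑.horizon →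
    ∃ (Ψ : ℝ × E3 → 𝓑.carrier) (Φ : 𝓑.carrier → ℝ × E3),
      (∀ z : ℝ × E3, 1 ≤ ‖z.2‖ → Φ (Ψ z) = z) ∧
      (∀ p ∈ 𝓑.doc ∪ 𝓑.horizon, Ψ (Φ p) = p) ∧
      Ψ '' {z : ℝ × E3 | 1 < ‖z.2‖} = 𝓑.doc ∧
      Ψ '' {z : ℝ × E3 | ‖z.2‖ = 1} = 𝓑.horizon ∧
      ContinuousOn Ψ {z : ℝ × E3 | 1 ≤ ‖z.2‖} ∧
      ContinuousOn Φ (𝓑.doc ∪ 𝓑.horizon) ∧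
      ContMDiffOn 𝓘(ℝ, ℝ × E3) (𝓡 4) ((⊤ : ℕ∞) : WithTop ℕ∞) Ψ {z : ℝ × E3 | 1 < ‖z.2‖} ∧
      ContMDiffOn (𝓡 4) 𝓘(ℝ, ℝ × E3) ((⊤ : ℕ∞) : WithTop ℕ∞) Φ 𝓑.doc ∧
      ∀ x : E3, 1 ≤ ‖x‖ → IsMIntegralCurve (fun t : ℝ ↦ Ψ (t, x)) 𝓑.killing

end Literature.Geometry.Lorentzian

end
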